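import Summits.AtomisticToContinuum.FouriersLaw.Theorems.LocalOhmBVLocalOhmStubWindowEnergyCovarianceWeakAux1

/-!
# Window–energy covariance, helpers II: reflection transport of the term covariances; geometric bookkeeping

Helper file for stub `stub_windowEnergyCovarianceWeak_of_termDecay` (T1) of the birth line of crux
`LocalOhmBV.LocalOhm` (item stmt-AtomisticToContinuum-12009).

* `cov_U_siteReflection`, `cov_V_siteReflection` — the covariances of a window observable
  `G = g ∘ boxRestrictAt a n ∘ embed N c` with `U(q_t)` and with `V(q_{t+1} - q_t)` under `μ_{N,T}` equal the
  covariances of the REFLECTED window observable (profile `g ∘ rev` on the window `N-1-(a+c)-n, …, N-1-(a+c)`,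
  centre `0`) with `U(q_{rev t})`, resp. `V(q_{rev t} - q_{rev(t+1)})` (the site reflection preserves `μ_{N,T}`
  and `V` is even) — so per-term decay to the RIGHT of a window gives decay to the LEFT as well;
* `sum_fin_three_parts_le`, `abs_sum_ite_succ_le`, `abs_cov_sum_le` — the bookkeeping: a family indexed by the
  sites of the chain which decays geometrically to the left of `e`, is bounded on `[e, e+k)` and decays
  geometrically to the right of `e + k` has sum `≤ C_L/(1-r_L) + k K + C_R/(1-r_R)`, and the resulting bound for
  `Σ_t Cov(G, p_t²/2) + Σ_t Cov(G, U(q_t)) + Σ_t Σ_{t'} [t' = t+1] Cov(G, V(q_{t'} - q_t))`.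

Folklore; no definitions.
-/

set_option autoImplicit false

noncomputable section

namespace Summit.AtomisticToContinuum.FouriersLaw.Theorems.LocalOhmBirth.WindowEnergyCovariance

open MeasureTheory Filter Topology
open scoped BigOperators
open Literature.MathematicalPhysics.KineticTheory Literature.MathematicalPhysics.KineticTheory.HeatConduction
open Summit.AtomisticToContinuum.FouriersLaw.Theorems.WindowLimit (embed)
open Summit.AtomisticToContinuum.FouriersLaw.Theorems.NonBallistic (measurePreserving_siteReflection_gibbsMeasure)

/-! ### Reflection transport of the term covariances -/

/-- **Reflection transport, pinning terms**: `Cov_{μ_{N,T}}(G, U(q_t)) = Cov_{μ_{N,T}}(G', U(q_{rev t}))` with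
`G'` the window observable of reversed profile on the reflected window (centre `0`, anchor `N-1-(a+c)-n`).
[folklore] -/
theorem cov_U_siteReflection (ω₂ lam β γ T : ℝ) {n : ℕ} (g : (Fin (n + 1) → ℝ × ℝ) → ℝ) {N c : ℕ} {a : ℤ}
    (h0 : 0 ≤ a + c) (hN : a + c + n < N) (t : Fin N) :
    (∫ z, g (boxRestrictAt a n (embed N c z)) * (pinnedChain ω₂ lam β γ).U (z.1 t)
          ∂((pinnedChain ω₂ lam β γ).gibbsMeasure N T)) -
        (∫ z, g (boxRestrictAt a n (embed N c z)) ∂((pinnedChain ω₂ lam β γ).gibbsMeasure N T)) *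
          (∫ z, (pinnedChain ω₂ lam β γ).U (z.1 t) ∂((pinnedChain ω₂ lam β γ).gibbsMeasure N T)) =
      (∫ z, g (fun i => boxRestrictAt ((N : ℤ) - 1 - (a + c) - n) n (embed N 0 z) (Fin.rev i)) *
            (pinnedChain ω₂ lam β γ).U (z.1 (Fin.rev t)) ∂((pinnedChain ω₂ lam β γ).gibbsMeasure N T)) -
        (∫ z, g (fun i => boxRestrictAt ((N : ℤ) - 1 - (a + c) - n) n (embed N 0 z) (Fin.rev i))
            ∂((pinnedChain ω₂ lam β γ).gibbsMeasure N T)) *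
          (∫ z, (pinnedChain ω₂ lam β γ).U (z.1 (Fin.rev t)) ∂((pinnedChain ω₂ lam β γ).gibbsMeasure N T)) := by
  set P := pinnedChain ω₂ lam β γ with hP
  set μ := P.gibbsMeasure N T with hμ
  have hR : MeasurePreserving (siteReflection N) μ μ :=
    measurePreserving_siteReflection_gibbsMeasure P (pinnedChain_V_neg ω₂ lam β γ) N T
  have emb := (siteReflectionEquiv N).measurableEmbedding
  have hbox : ∀ z : PhaseSpace N, boxRestrictAt a n (embed N c (siteReflection N z)) =
      fun i => boxRestrictAt ((N : ℤ) - 1 - (a + c) - n) n (embed N 0 z) (Fin.rev i) := fun z =>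
    funext fun i => boxRestrictAt_embed_siteReflection h0 hN z i
  have e1 : ∫ z, g (boxRestrictAt a n (embed N c z)) * P.U (z.1 t) ∂μ =
      ∫ z, g (fun i => boxRestrictAt ((N : ℤ) - 1 - (a + c) - n) n (embed N 0 z) (Fin.rev i)) *
        P.U (z.1 (Fin.rev t)) ∂μ := by
    rw [← hR.integral_comp emb (fun y => g (boxRestrictAt a n (embed N c y)) * P.U (y.1 t))]
    refine integral_congr_ae (Eventually.of_forall fun z => ?_)
    show g (boxRestrictAt a n (embed N c (siteReflection N z))) * P.U ((siteReflection N z).1 t) = _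
    rw [hbox z, siteReflection_fst]
  have e2 : ∫ z, g (boxRestrictAt a n (embed N c z)) ∂μ =
      ∫ z, g (fun i => boxRestrictAt ((N : ℤ) - 1 - (a + c) - n) n (embed N 0 z) (Fin.rev i)) ∂μ := by
    rw [← hR.integral_comp emb (fun y => g (boxRestrictAt a n (embed N c y)))]
    refine integral_congr_ae (Eventually.of_forall fun z => ?_)
    show g (boxRestrictAt a n (embed N c (siteReflection N z))) = _
    rw [hbox z]
  have e3 : ∫ z, P.U (z.1 t) ∂μ = ∫ z, P.U (z.1 (Fin.rev t)) ∂μ := by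
    rw [← hR.integral_comp emb (fun y => P.U (y.1 t))]
    rfl
  rw [e1, e2, e3]

/-- **Reflection transport, bond terms**: `Cov_{μ_{N,T}}(G, V(q_{t'} - q_t)) = Cov_{μ_{N,T}}(G', V(q_{rev t} - q_{rev t'}))`
(`V` even; for `t' = t + 1` the reflected pair `(rev t', rev t)` is again a bond, `rev t = rev t' + 1`). [folklore] -/
theorem cov_V_siteReflection (ω₂ lam β γ T : ℝ) {n : ℕ} (g : (Fin (n + 1) → ℝ × ℝ) → ℝ) {N c : ℕ} {a : ℤ}
    (h0 : 0 ≤ a + c) (hN : a + c + n < N) (t t' : Fin N) :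
    (∫ z, g (boxRestrictAt a n (embed N c z)) * (pinnedChain ω₂ lam β γ).V (z.1 t' - z.1 t)
          ∂((pinnedChain ω₂ lam β γ).gibbsMeasure N T)) -
        (∫ z, g (boxRestrictAt a n (embed N c z)) ∂((pinnedChain ω₂ lam β γ).gibbsMeasure N T)) *
          (∫ z, (pinnedChain ω₂ lam β γ).V (z.1 t' - z.1 t) ∂((pinnedChain ω₂ lam β γ).gibbsMeasure N T)) =
      (∫ z, g (fun i => boxRestrictAt ((N : ℤ) - 1 - (a + c) - n) n (embed N 0 z) (Fin.rev i)) *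
            (pinnedChain ω₂ lam β γ).V (z.1 (Fin.rev t) - z.1 (Fin.rev t'))
            ∂((pinnedChain ω₂ lam β γ).gibbsMeasure N T)) -
        (∫ z, g (fun i => boxRestrictAt ((N : ℤ) - 1 - (a + c) - n) n (embed N 0 z) (Fin.rev i))
            ∂((pinnedChain ω₂ lam β γ).gibbsMeasure N T)) *
          (∫ z, (pinnedChain ω₂ lam β γ).V (z.1 (Fin.rev t) - z.1 (Fin.rev t'))
            ∂((pinnedChain ω₂ lam β γ).gibbsMeasure N T)) := by
  set P := pinnedChain ω₂ lam β γ with hP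
  set μ := P.gibbsMeasure N T with hμ
  have hV : ∀ r, P.V (-r) = P.V r := pinnedChain_V_neg ω₂ lam β γ
  have hR : MeasurePreserving (siteReflection N) μ μ := measurePreserving_siteReflection_gibbsMeasure P hV N T
  have emb := (siteReflectionEquiv N).measurableEmbedding
  have hbox : ∀ z : PhaseSpace N, boxRestrictAt a n (embed N c (siteReflection N z)) =
      fun i => boxRestrictAt ((N : ℤ) - 1 - (a + c) - n) n (embed N 0 z) (Fin.rev i) := fun z =>
    funext fun i => boxRestrictAt_embed_siteReflection h0 hN z i
  have hflip : ∀ z : PhaseSpace N, P.V (z.1 (Fin.rev t') - z.1 (Fin.rev t)) =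
      P.V (z.1 (Fin.rev t) - z.1 (Fin.rev t')) := fun z => by
    rw [← hV, neg_sub]
  have e1 : ∫ z, g (boxRestrictAt a n (embed N c z)) * P.V (z.1 t' - z.1 t) ∂μ =
      ∫ z, g (fun i => boxRestrictAt ((N : ℤ) - 1 - (a + c) - n) n (embed N 0 z) (Fin.rev i)) *
        P.V (z.1 (Fin.rev t) - z.1 (Fin.rev t')) ∂μ := by
    rw [← hR.integral_comp emb (fun y => g (boxRestrictAt a n (embed N c y)) * P.V (y.1 t' - y.1 t))]
    refine integral_congr_ae (Eventually.of_forall fun z => ?_)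
    show g (boxRestrictAt a n (embed N c (siteReflection N z))) *
      P.V ((siteReflection N z).1 t' - (siteReflection N z).1 t) = _
    rw [hbox z, siteReflection_fst, siteReflection_fst, hflip z]
  have e2 : ∫ z, g (boxRestrictAt a n (embed N c z)) ∂μ =
      ∫ z, g (fun i => boxRestrictAt ((N : ℤ) - 1 - (a + c) - n) n (embed N 0 z) (Fin.rev i)) ∂μ := by
    rw [← hR.integral_comp emb (fun y => g (boxRestrictAt a n (embed N c y)))]
    refine integral_congr_ae (Eventually.of_forall fun z => ?_)
    show g (boxRestrictAt a n (embed N c (siteReflection N z))) = _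
    rw [hbox z]
  have e3 : ∫ z, P.V (z.1 t' - z.1 t) ∂μ = ∫ z, P.V (z.1 (Fin.rev t) - z.1 (Fin.rev t')) ∂μ := by
    rw [← hR.integral_comp emb (fun y => P.V (y.1 t' - y.1 t))]
    refine integral_congr_ae (Eventually.of_forall fun z => ?_)
    show P.V ((siteReflection N z).1 t' - (siteReflection N z).1 t) = _
    rw [siteReflection_fst, siteReflection_fst, hflip z]
  rw [e1, e2, e3]

/-! ### Geometric bookkeeping over the sites of the chain -/

/-- A family over `[0, N)` decaying geometrically to the left of `e`, bounded by `K` on `[e, e+k)` and decaying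
geometrically to the right of `e + k` has sum `≤ C_L/(1-r_L) + k K + C_R/(1-r_R)`. [folklore] -/
theorem sum_range_three_parts_le {N e k : ℕ} (hek : e + k ≤ N) (f : ℕ → ℝ) {CL rL K CR rR : ℝ}
    (hrL0 : 0 ≤ rL) (hrL1 : rL < 1) (hrR0 : 0 ≤ rR) (hrR1 : rR < 1) (hCL : 0 ≤ CL) (hCR : 0 ≤ CR)
    (hL : ∀ t, t < e → f t ≤ CL * rL ^ (e - 1 - t))
    (hM : ∀ t, e ≤ t → t < e + k → f t ≤ K)
    (hR : ∀ t, e + k ≤ t → t < N → f t ≤ CR * rR ^ (t - (e + k))) :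
    ∑ t ∈ Finset.range N, f t ≤ CL / (1 - rL) + k * K + CR / (1 - rR) := by
  rw [Finset.range_eq_Ico, ← Finset.sum_Ico_consecutive f (Nat.zero_le e) (by omega : e ≤ N),
    ← Finset.sum_Ico_consecutive f (Nat.le_add_right e k) hek]
  have hgeo : ∀ {x : ℝ}, 0 ≤ x → x < 1 → ∀ M : ℕ, ∑ t ∈ Finset.range M, x ^ t ≤ 1 / (1 - x) := by
    intro x hx0 hx1 M
    have h := geom_sum_Ico_le_of_lt_one hx0 hx1 (m := 0) (n := M)
    rwa [pow_zero, ← Finset.range_eq_Ico] at h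
  have h1 : ∑ t ∈ Finset.Ico 0 e, f t ≤ CL / (1 - rL) := by
    calc ∑ t ∈ Finset.Ico 0 e, f t ≤ ∑ t ∈ Finset.Ico 0 e, CL * rL ^ (e - 1 - t) :=
          Finset.sum_le_sum fun t ht => hL t (Finset.mem_Ico.1 ht).2
      _ = CL * ∑ t ∈ Finset.range e, rL ^ t := by
          rw [← Finset.mul_sum, ← Finset.range_eq_Ico,
            show ∑ t ∈ Finset.range e, rL ^ (e - 1 - t) = ∑ t ∈ Finset.range e, rL ^ t from
              Finset.sum_range_reflect (fun t => rL ^ t) e]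
      _ ≤ CL * (1 / (1 - rL)) := mul_le_mul_of_nonneg_left (hgeo hrL0 hrL1 e) hCL
      _ = CL / (1 - rL) := by ring
  have h2 : ∑ t ∈ Finset.Ico e (e + k), f t ≤ k * K := by
    calc ∑ t ∈ Finset.Ico e (e + k), f t ≤ ∑ t ∈ Finset.Ico e (e + k), K :=
          Finset.sum_le_sum fun t ht => hM t (Finset.mem_Ico.1 ht).1 (Finset.mem_Ico.1 ht).2
      _ = k * K := by rw [Finset.sum_const, Nat.card_Ico, Nat.add_sub_cancel_left, nsmul_eq_mul]
  have h3 : ∑ t ∈ Finset.Ico (e + k) N, f t ≤ CR / (1 - rR) := by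
    calc ∑ t ∈ Finset.Ico (e + k) N, f t ≤ ∑ t ∈ Finset.Ico (e + k) N, CR * rR ^ (t - (e + k)) :=
          Finset.sum_le_sum fun t ht => hR t (Finset.mem_Ico.1 ht).1 (Finset.mem_Ico.1 ht).2
      _ = CR * ∑ j ∈ Finset.range (N - (e + k)), rR ^ j := by
          rw [← Finset.mul_sum, Finset.sum_Ico_eq_sum_range]
          refine congrArg _ (Finset.sum_congr rfl fun j _ => ?_)
          rw [Nat.add_sub_cancel_left]
      _ ≤ CR * (1 / (1 - rR)) := mul_le_mul_of_nonneg_left (hgeo hrR0 hrR1 _) hCR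
      _ = CR / (1 - rR) := by ring
  linarith

/-- The same bookkeeping for a family indexed by `Fin N`. [folklore] -/
theorem sum_fin_three_parts_le {N e k : ℕ} (hek : e + k ≤ N) (F : Fin N → ℝ) {CL rL K CR rR : ℝ}
    (hrL0 : 0 ≤ rL) (hrL1 : rL < 1) (hrR0 : 0 ≤ rR) (hrR1 : rR < 1) (hCL : 0 ≤ CL) (hCR : 0 ≤ CR)
    (hL : ∀ t : Fin N, t.val < e → F t ≤ CL * rL ^ (e - 1 - t.val))
    (hM : ∀ t : Fin N, e ≤ t.val → t.val < e + k → F t ≤ K)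
    (hR : ∀ t : Fin N, e + k ≤ t.val → F t ≤ CR * rR ^ (t.val - (e + k))) :
    ∑ t, F t ≤ CL / (1 - rL) + k * K + CR / (1 - rR) := by
  set f : ℕ → ℝ := fun t => if h : t < N then F ⟨t, h⟩ else 0 with hf
  have hfF : ∀ (t : ℕ) (h : t < N), f t = F ⟨t, h⟩ := fun t h => by simp [hf, h]
  have hFf : ∀ t : Fin N, F t = f t.val := fun t => (hfF t.val t.isLt).symm
  calc ∑ t, F t = ∑ t : Fin N, f t.val := Finset.sum_congr rfl fun t _ => hFf t
    _ = ∑ t ∈ Finset.range N, f t := Fin.sum_univ_eq_sum_range f N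
    _ ≤ _ := sum_range_three_parts_le hek f hrL0 hrL1 hrR0 hrR1 hCL hCR (fun t ht => ?_)
        (fun t h1 h2 => ?_) (fun t h1 h2 => ?_)
  · have htN : t < N := by omega
    rw [hfF t htN]; exact hL ⟨t, htN⟩ ht
  · have htN : t < N := by omega
    rw [hfF t htN]; exact hM ⟨t, htN⟩ h1 h2
  · rw [hfF t h2]; exact hR ⟨t, h2⟩ h1

/-- At most one `j` has `j = t + 1`: `|Σ_j [j = t+1] v_j| ≤ X` as soon as `|v_{t+1}| ≤ X` (`X ≥ 0`). [folklore] -/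
theorem abs_sum_ite_succ_le {N : ℕ} (t : Fin N) (v : Fin N → ℝ) {X : ℝ} (hX : 0 ≤ X)
    (h : ∀ j : Fin N, j.val = t.val + 1 → |v j| ≤ X) :
    |∑ j : Fin N, (if j.val = t.val + 1 then v j else 0)| ≤ X := by
  by_cases ht : t.val + 1 < N
  · have heq : ∀ j : Fin N, (j.val = t.val + 1) ↔ j = ⟨t.val + 1, ht⟩ := fun j => by
      rw [Fin.ext_iff]
    simp_rw [heq, Finset.sum_ite_eq', Finset.mem_univ, if_true]
    exact h _ rfl
  · have hne : ∀ j : Fin N, ¬ (j.val = t.val + 1) := fun j hj => ht (hj ▸ j.isLt)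
    simp only [hne, if_false, Finset.sum_const_zero, abs_zero]
    exact hX

/-- **Assembly of the per-term bounds.** Kinetic covariances vanish off the window `[e, e+n]` and are `≤ K_k`
on it; pinning and bond covariances decay geometrically to the left of `e` (rate `r'`, constant `C'`) and to
the right of `e + n` (rate `r`, constant `C`) and are bounded by `K_U`, `K_V` in between; then the total is
bounded independently of `N` and `e`. [folklore] -/
theorem abs_cov_sum_le {N e n : ℕ} (hen : e + n < N) (covk covU : Fin N → ℝ) (covV : Fin N → Fin N → ℝ)
    {Kk KU KV C r C' r' : ℝ} (hKV : 0 ≤ KV) (hC : 0 ≤ C) (hr0 : 0 ≤ r) (hr1 : r < 1)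
    (hC' : 0 ≤ C') (hr0' : 0 ≤ r') (hr1' : r' < 1)
    (hk0 : ∀ t : Fin N, t.val < e ∨ e + n < t.val → covk t = 0) (hkM : ∀ t : Fin N, |covk t| ≤ Kk)
    (hUL : ∀ t : Fin N, t.val < e → |covU t| ≤ C' * r' ^ (e - 1 - t.val))
    (hUM : ∀ t : Fin N, |covU t| ≤ KU)
    (hUR : ∀ t : Fin N, e + n ≤ t.val → |covU t| ≤ C * r ^ (t.val - (e + n)))
    (hVL : ∀ t t' : Fin N, t'.val = t.val + 1 → t.val < e → |covV t t'| ≤ C' * r' ^ (e - 1 - t.val))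
    (hVM : ∀ t t' : Fin N, t'.val = t.val + 1 → |covV t t'| ≤ KV)
    (hVR : ∀ t t' : Fin N, t'.val = t.val + 1 → e + n ≤ t.val → |covV t t'| ≤ C * r ^ (t.val - (e + n))) :
    |(∑ i : Fin N, (covk i + covU i)) + ∑ i : Fin N, ∑ j : Fin N, (if j.val = i.val + 1 then covV i j else 0)| ≤
      (n + 1) * Kk + (C' / (1 - r') + n * KU + C / (1 - r)) + (C' / (1 - r') + n * KV + C / (1 - r)) := by
  have e1 : ∑ i : Fin N, |covk i| ≤ (n + 1) * Kk := by
    have h := sum_fin_three_parts_le (e := e) (k := n + 1) (by omega) (fun i => |covk i|) (CL := 0) (rL := 0)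
      (CR := 0) (rR := 0) (K := Kk) le_rfl zero_lt_one le_rfl zero_lt_one le_rfl le_rfl
      (fun t ht => by rw [hk0 t (Or.inl ht), abs_zero, zero_mul]) (fun t _ _ => hkM t)
      (fun t ht => by rw [hk0 t (Or.inr (by omega)), abs_zero, zero_mul])
    simpa using h
  have e2 : ∑ i : Fin N, |covU i| ≤ C' / (1 - r') + n * KU + C / (1 - r) :=
    sum_fin_three_parts_le (by omega) _ hr0' hr1' hr0 hr1 hC' hC hUL (fun t _ _ => hUM t) hUR
  have e3 : ∑ i : Fin N, |∑ j : Fin N, (if j.val = i.val + 1 then covV i j else 0)| ≤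
      C' / (1 - r') + n * KV + C / (1 - r) :=
    sum_fin_three_parts_le (by omega) _ hr0' hr1' hr0 hr1 hC' hC
      (fun t ht => abs_sum_ite_succ_le t (covV t) (by positivity) fun j hj => hVL t j hj ht)
      (fun t _ _ => abs_sum_ite_succ_le t (covV t) hKV fun j hj => hVM t j hj)
      (fun t ht => abs_sum_ite_succ_le t (covV t) (by positivity) fun j hj => hVR t j hj ht)
  calc |(∑ i : Fin N, (covk i + covU i)) + ∑ i : Fin N, ∑ j : Fin N, (if j.val = i.val + 1 then covV i j else 0)|
      = |(∑ i : Fin N, covk i) + (∑ i : Fin N, covU i) +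
          ∑ i : Fin N, ∑ j : Fin N, (if j.val = i.val + 1 then covV i j else 0)| := by
        rw [Finset.sum_add_distrib]
    _ ≤ |∑ i : Fin N, covk i| + |∑ i : Fin N, covU i| +
          |∑ i : Fin N, ∑ j : Fin N, (if j.val = i.val + 1 then covV i j else 0)| := abs_add_three _ _ _
    _ ≤ (∑ i : Fin N, |covk i|) + (∑ i : Fin N, |covU i|) +
          ∑ i : Fin N, |∑ j : Fin N, (if j.val = i.val + 1 then covV i j else 0)| :=
        add_le_add (add_le_add (Finset.abs_sum_le_sum_abs _ _) (Finset.abs_sum_le_sum_abs _ _))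
          (Finset.abs_sum_le_sum_abs _ _)
    _ ≤ _ := add_le_add (add_le_add e1 e2) e3

/-- **Registered sub-goal (helper II of T1 `stub_windowEnergyCovarianceWeak_of_termDecay`)**: reflection transport of
the pinning-term covariances — `Cov_{μ_{N,T}}(g ∘ box_a ∘ embed_c, U(q_t))` equals the covariance of the window
observable with REVERSED profile on the reflected window (anchor `N-1-(a+c)-n`, centre `0`) with `U(q_{rev t})`, for
every chain length, window and site (the site reflection preserves the Gibbs state; no integrability needed). [folklore] -/
theorem windowEnergy_covU_siteReflection :
    ∀ (ω₂ lam β γ T : ℝ) (n : ℕ) (g : (Fin (n + 1) → ℝ × ℝ) → ℝ) (N c : ℕ) (a : ℤ), 0 ≤ a + c → a + c + n < N →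
    ∀ t : Fin N,
      (∫ z, g (boxRestrictAt a n (embed N c z)) * (pinnedChain ω₂ lam β γ).U (z.1 t)
            ∂((pinnedChain ω₂ lam β γ).gibbsMeasure N T)) -
          (∫ z, g (boxRestrictAt a n (embed N c z)) ∂((pinnedChain ω₂ lam β γ).gibbsMeasure N T)) *
            (∫ z, (pinnedChain ω₂ lam β γ).U (z.1 t) ∂((pinnedChain ω₂ lam β γ).gibbsMeasure N T)) =
        (∫ z, g (fun i => boxRestrictAt ((N : ℤ) - 1 - (a + c) - n) n (embed N 0 z) (Fin.rev i)) *
              (pinnedChain ω₂ lam β γ).U (z.1 (Fin.rev t)) ∂((pinnedChain ω₂ lam β γ).gibbsMeasure N T)) -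
          (∫ z, g (fun i => boxRestrictAt ((N : ℤ) - 1 - (a + c) - n) n (embed N 0 z) (Fin.rev i))
              ∂((pinnedChain ω₂ lam β γ).gibbsMeasure N T)) *
            (∫ z, (pinnedChain ω₂ lam β γ).U (z.1 (Fin.rev t)) ∂((pinnedChain ω₂ lam β γ).gibbsMeasure N T)) :=
  fun ω₂ lam β γ T _n g _N _c _a h0 hN t => cov_U_siteReflection ω₂ lam β γ T g h0 hN t

end Summit.AtomisticToContinuum.FouriersLaw.Theorems.LocalOhmBirth.WindowEnergyCovariance

end
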